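import Literature.Barriers.AtomisticToContinuum.AnticontinuumLocalizationThm2Proof
import HarnessLib

/-!
# De Roeck–Huveneers 2015, Theorem 1 (rotor chain): the statement in the scope of its printed proof

`Literature/Barriers/AtomisticToContinuum/` (barrier catalogue, sub-problem `FouriersLaw`).
`AnticontinuumLocalization.lean` vendors Theorem 1 of W. De Roeck, F. Huveneers, *Asymptotic
localization of energy in nondisordered oscillator chains*, Comm. Pure Appl. Math. **68** (2015)
1532–1568, arXiv:1305.5127, as the named fact `DeRoeckHuveneers2015_thm1`, with the printed
wording "For any `N ≥ 1` and `a ∈ ℤ_N`" rendered as `∀ N, Odd N → ∀ a` after the choice of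
`C, ε₀` (uniformity in `N`).

Scope of the printed proof (recorded by the provefact seat of that fact, 2026-08-15). The proof of
Theorem 1 (§§3–5 of the source) is an infinite-volume argument. Its Lemma 4 (§5.5, first
assertion: `L_{H̃} H̃_{>a} ≠ 0 ⟹ (ω, q) ∈ Z`) is obtained as follows (proof of Lemma 4, first point): from one site
`x ∈ B(a, n₃)` with `θ_x < 1` one gets a vector `k₁ ∈ K_r`, `supp k₁ ⊂ B(x, 4r)`, with
`|ω · k₁| ≤ L^{n₂+1} δ`; "Let us now take another `x'` such that … `|x - x'| > 4r`. Then the same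
reasoning gives a vector `k'₁ ≠ k₁` … By taking `n₃` large enough, we can find `n₂` linearly
independent vectors and thus guarantee that `ω ∈ Z`." This needs `n₂` sites of the chain near `a`
pairwise more than `4r` apart, i.e. a chain of at least `N₀(γ, T, n)` sites
(`n₂ = 16 n + 8`, `n₁ = 2n + 1`, `r = r(n₁)`, `δ = ε^{1/4}`, §5.6); chains with fewer sites are
not treated in the source. Accordingly the tree's formalisation of §§3–5
(`AnticontinuumLocalization{Geometry…, NormalForm…, Cutoffs, Cancellation, ZeroSet, ZMeasure,
Bounds…, Assembly, Thm1Window, Thm1Transplant, Thm1Reduction, Thm2Proof}.lean`) proves the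
conclusion of Theorem 1 for all odd `N ≥ N₀` (`DeRoeckHuveneers2015_thm1_largeN`) and, from it,
the barrier `DeRoeckHuveneers2015_thm2_holds` (an `N → ∞` statement), while
`DeRoeckHuveneers2015_thm1` itself (every odd `N`, in particular fixed small `N` at every order
`n`) is not discharged.

This file names the supported statement and proves it:

* `DeRoeckHuveneers2015_thm1_largeChains` — Theorem 1 with "`∃ N₀, ∀ odd N ≥ N₀`" in place of
  "`∀ odd N`", otherwise literally the block of `DeRoeckHuveneers2015_thm1`;
* `DeRoeckHuveneers2015_thm1_largeChains_holds` — PROVED (from `DeRoeckHuveneers2015_thm1_largeN`);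
* `DeRoeckHuveneers2015_thm1_largeChains_of_thm1` — the vendored all-`N` fact implies it
  (`N₀ = 0`).

Searched: `lean search DeRoeckHuveneers2015_thm1` — the tree has the all-`N` fact, the large-`N`
theorem `…_thm1_largeN` (an anonymous-statement theorem in `…Thm2Proof.lean`) and the conditional
reductions `…_thm1_of_windowSolutions`, `…_thm2_of_thm1`, `…_thm4_of_thm1`; no named statement of
the large-chain form existed.
-/

noncomputable section

open MeasureTheory
open scoped ContDiff

namespace Literature.Barriers.AtomisticToContinuum

open Literature.MathematicalPhysics.KineticTheory.HeatConduction HeatConduction HeatConduction.RotorChain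

/-- **De Roeck–Huveneers 2015, Theorem 1 (rotor chain), for large chains — the statement its
printed proof establishes.** For `γ ≥ 0`, `T > 0` and `n ≥ 1` there are `N₀`, `C` and `ε₀ > 0`
such that for all `ε ∈ (0, ε₀)`, every odd `N ≥ N₀` and every site `a` there are smooth
`2π`-angle-periodic `U_a, G_a` on `Ω_N`, of zero Gibbs average, depending only on the variables at
sites within `C` of `a`, with `ε J_{a,a+1} = L_H U_a + ε^{n+1} G_a` and
`⟨U_a²⟩_T ≤ C ε^{1/4}`, `⟨(∂_♯ U_a)²⟩_T ≤ C ε^{-1/4}`, `⟨G_a²⟩_T ≤ C`, `⟨(∂_♯ G_a)²⟩_T ≤ C`.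
This is `DeRoeckHuveneers2015_thm1` with `∃ N₀, ∀ odd N ≥ N₀` in place of `∀ odd N`: the printed
statement says "For any `N ≥ 1`", but the printed proof (§5.5 Lemma 4: "`n₂` linearly independent
vectors" from `n₂` well separated sites of `B(a, n₃)`, "taking `n₃` large enough") requires the
chain to have at least `N₀(γ, T, n)` sites and does not treat smaller chains — see the module
docstring. PROVED below. [cite: DeRoeckHuveneers2015, §2.3 Thm 1 and §5.5 Lemma 4] -/
def DeRoeckHuveneers2015_thm1_largeChains : Prop :=
  ∀ γ : ℝ, 0 ≤ γ → ∀ T : ℝ, 0 < T → ∀ n : ℕ, 1 ≤ n →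
    ∃ N₀ : ℕ, ∃ C : ℝ, ∃ ε₀ : ℝ, 0 < ε₀ ∧ ∀ ε : ℝ, 0 < ε → ε < ε₀ →
      ∀ N : ℕ, N₀ ≤ N → Odd N → ∀ a : Fin N,
        ∃ U G : PhaseSpace N → ℝ,
          ContDiff ℝ ∞ U ∧ ContDiff ℝ ∞ G ∧ IsAnglePeriodic N U ∧ IsAnglePeriodic N G ∧
          DependsOnlyNear N a C U ∧ DependsOnlyNear N a C G ∧
          Integrable U (gibbsMeasure N T ε γ) ∧ Integrable G (gibbsMeasure N T ε γ) ∧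
          ∫ z, U z ∂(gibbsMeasure N T ε γ) = 0 ∧ ∫ z, G z ∂(gibbsMeasure N T ε γ) = 0 ∧
          (∀ z : PhaseSpace N,
            ε * bondCurrent N a z = liouville N ε γ U z + ε ^ (n + 1) * G z) ∧
          Integrable (fun z => U z ^ 2) (gibbsMeasure N T ε γ) ∧
          ∫ z, U z ^ 2 ∂(gibbsMeasure N T ε γ) ≤ C * ε ^ (1 / 4 : ℝ) ∧
          Integrable (fun z => G z ^ 2) (gibbsMeasure N T ε γ) ∧
          ∫ z, G z ^ 2 ∂(gibbsMeasure N T ε γ) ≤ C ∧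
          ∀ x : Fin N,
            Integrable (fun z => partialQ x U z ^ 2) (gibbsMeasure N T ε γ) ∧
            ∫ z, partialQ x U z ^ 2 ∂(gibbsMeasure N T ε γ) ≤ C * ε ^ (-(1 / 4) : ℝ) ∧
            Integrable (fun z => partialP x U z ^ 2) (gibbsMeasure N T ε γ) ∧
            ∫ z, partialP x U z ^ 2 ∂(gibbsMeasure N T ε γ) ≤ C * ε ^ (-(1 / 4) : ℝ) ∧
            Integrable (fun z => partialQ x G z ^ 2) (gibbsMeasure N T ε γ) ∧
            ∫ z, partialQ x G z ^ 2 ∂(gibbsMeasure N T ε γ) ≤ C ∧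
            Integrable (fun z => partialP x G z ^ 2) (gibbsMeasure N T ε γ) ∧
            ∫ z, partialP x G z ^ 2 ∂(gibbsMeasure N T ε γ) ≤ C

/-- **Discharge**: the large-chain Theorem 1 holds, by the tree's formalisation of §§3–5 of the
source (`DeRoeckHuveneers2015_thm1_largeN`). [cite: DeRoeckHuveneers2015, §2.3 Thm 1, §§3–5] -/
theorem DeRoeckHuveneers2015_thm1_largeChains_holds : DeRoeckHuveneers2015_thm1_largeChains := by
  intro γ hγ T hT n _hn
  obtain ⟨N₀, C, ε₀, _hC, hε₀, h⟩ := DeRoeckHuveneers2015_thm1_largeN γ hγ T hT n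
  exact ⟨N₀, C, ε₀, hε₀, h⟩

/-- The vendored all-`N` fact implies the large-chain statement (with `N₀ = 0`); the converse
direction is exactly the untreated small-chain case. [cite: DeRoeckHuveneers2015, §2.3 Thm 1] -/
theorem DeRoeckHuveneers2015_thm1_largeChains_of_thm1 (h : DeRoeckHuveneers2015_thm1) :
    DeRoeckHuveneers2015_thm1_largeChains := by
  intro γ hγ T hT n hn
  obtain ⟨C, ε₀, hε₀, hall⟩ := h γ hγ T hT n hn
  exact ⟨0, C, ε₀, hε₀, fun ε hε hεε N _ hN a => hall ε hε hεε N hN a⟩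

end Literature.Barriers.AtomisticToContinuum

end
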